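import Summits.BirchSwinnertonDyer.BirchSwinnertonDyer.Theorems.ManinLocalTwoThreeTowerLawConsequences
import Summits.BirchSwinnertonDyer.Rank1Residual.ManinAdditive.CuspidalKummerCubeLaws
import HarnessLib

/-!
# RES₃♭ (stub 6 of `Lines/kato_shift_three.lean` v18) RE-CUT BY NAME onto the es/an road:
# `NoRationalThreeTorsionCoprimeIsolatedResidual` ⟸ {F-es-18♭K, `KatoCurveExists`, E-es-67♯ (or E-an-128), plus-defect-at-3 clause}
# given modularity, with E-an-135₃ `TowerUnitTwist 3` DISCHARGED
# (route `ManinLocalTwoThree`, crux C3 `ManinPrimeToThreeAtNine` stmt-BirchSwinnertonDyer-22968; cell bsd-f2-manin, width seat p2 gen 13)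

The C3 LEAD keeps RES₃♭ as ONE registered stub and records its closure map only in the audit (HOME/p1/AUDIT-p1-g9.md: «importing that
road as stubs would replace ONE named residual by ≥ 4 laws/facts»).  This file makes that closure map a KERNEL edge onto the
registered signature `CuspidalKummerThree.NoRationalThreeTorsionCoprimeIsolatedResidual` VERBATIM:

* `noRationalThreeTorsionCoprimeIsolatedResidual_of_sharp` — RES₃♭ ⟸ `exists_isNewformOf` (the crux's own fourth binder) ∧
  `kato_isIntegral_twistedSymbolSum_three_symbolClosure` (F-es-18♭K, Kato 2004 Thm. 12.5 read at Kato's curve; statement-only) ∧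
  `KatoCurveExists` (S-es-K, true on paper) ∧ E-es-67♯ `PlusIndexPrimeToThreeOfMuThreeNoRationalThreeTorsion` ∧ the PLUS-DEFECT CLAUSE
  «on RES₃♭'s habitat (lattice-optimal, `9 ∣ N`, `W[3]` reducible, no rational short `3`-torsion) the cuspidal group has plus-defect
  prime to `3`» (inline hypothesis `CuspidalPlusDefectPrimeTo 3 D`; es E39 census `pd₃ = 0` on every class reached; NOT a typed row —
  displayed, not hidden).  The an/es tower input E-an-135₃ is the tree theorem `towerUnitTwist_three` (p2 g11) inside
  `not_three_dvd_maninConstant_of_no_shortThreeTorsion_of_sharp`.  The six «no twist partner» clauses of RES₃♭ are NOT used.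
* `noRationalThreeTorsionCoprimeIsolatedResidual_of_cuspLifting` — the same with E-es-67♯ replaced by an's E-an-128
  `ShimuraThreeForcesRationalThreeTorsion` (tree edge `plusIndexPrimeToThreeOfMuThreeNoRationalThreeTorsion_of_cuspLifting`).

HONEST FRAMING: a CONDITIONAL re-cut, no discharge: F-es-18♭K and `KatoCurveExists` are unformalised printed/paper facts, E-es-67♯ /
E-an-128 are cell laws, the plus-defect clause is a census-backed hypothesis.  What it buys the planner: RES₃♭ = (plus-defect clause)
∧ (E-es-67♯ ∨ E-an-128) modulo the two facts the rest of the line already carries — by name, kernel-checked.  C3, Manin's conjecture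
and BSD are NOT proved by this file; no definitions, no sorry.
-/

set_option autoImplicit false
-- lint-debt: the directory name repeats the summit name (sibling precedent `ManinLocalTwoThreeTowerLawConsequences.lean`)
set_option linter.dupNamespace false

noncomputable section

open scoped Classical MatrixGroups ModularForm

open CongruenceSubgroup Complex WeierstrassCurve Literature.NumberTheory.EllipticCurves
  Literature.NumberTheory.EllipticCurves.ModularForms
open Summit.BirchSwinnertonDyer.Rank1Residual.ManinAdditive.KatoCurve
  Summit.BirchSwinnertonDyer.Rank1Residual.ManinAdditive.CuspidalKummer
  Summit.BirchSwinnertonDyer.Rank1Residual.ManinAdditive.CuspidalKummerThree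

namespace Summit.BirchSwinnertonDyer.BirchSwinnertonDyer.Theorems.ManinLocalTwoThree

/-- **RES₃♭ BY NAME ⟸ F-es-18♭K ∧ `KatoCurveExists` ∧ E-es-67♯ ∧ (plus-defect-at-3 clause), given modularity.**  The registered
stub signature `NoRationalThreeTorsionCoprimeIsolatedResidual` of C3's line `kato_shift_three` from the es road's named inputs; the
tower input `TowerUnitTwist 3` is a tree theorem and does not appear.  [cite: Kato2004Asterisque, Thm. 12.5 (shape; the named fact is statement-only)]
[cite: DiamondShurman2005, Thm. 8.8.1] -/
theorem noRationalThreeTorsionCoprimeIsolatedResidual_of_sharp (hnf : exists_isNewformOf)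
    (hF : kato_isIntegral_twistedSymbolSum_three_symbolClosure) (hK : KatoCurveExists)
    (h67s : PlusIndexPrimeToThreeOfMuThreeNoRationalThreeTorsion)
    (hpd : ∀ (W : WeierstrassCurve ℚ) [W.IsElliptic] [W.IsGloballyMinimal] {N : ℕ} [NeZero N]
      (D : ModularParametrizationData W N),
      (∀ z ∈ D.L.lattice, ∃ w ∈ periodLattice D.f, z = D.c * w) → 3 ^ 2 ∣ N →
      ¬ W.HasIrreducibleModPGaloisRep 3 → (∀ X₀ Y₀ : ℚ, ¬ IsShortThreeTorsion W D.c X₀ Y₀) →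
      CuspidalPlusDefectPrimeTo 3 D) :
    NoRationalThreeTorsionCoprimeIsolatedResidual := by
  intro W _ _ N _ D hopt h9 _ _ _ _ _ _ _ hred hT
  exact not_three_dvd_maninConstant_of_no_shortThreeTorsion_of_sharp W hnf hF hK h67s D hopt h9
    (hpd W D hopt h9 hred hT) hT

/-- **RES₃♭ BY NAME with an's cusp-lifting law E-an-128 in place of E-es-67♯** (tree edge
`plusIndexPrimeToThreeOfMuThreeNoRationalThreeTorsion_of_cuspLifting`). [cite: Vatsal2005, Rem. 1.8 (shape only; E-an-128 is the cell's law)] -/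
theorem noRationalThreeTorsionCoprimeIsolatedResidual_of_cuspLifting (hnf : exists_isNewformOf)
    (hF : kato_isIntegral_twistedSymbolSum_three_symbolClosure) (hK : KatoCurveExists)
    (h128 : ShimuraThreeForcesRationalThreeTorsion)
    (hpd : ∀ (W : WeierstrassCurve ℚ) [W.IsElliptic] [W.IsGloballyMinimal] {N : ℕ} [NeZero N]
      (D : ModularParametrizationData W N),
      (∀ z ∈ D.L.lattice, ∃ w ∈ periodLattice D.f, z = D.c * w) → 3 ^ 2 ∣ N →
      ¬ W.HasIrreducibleModPGaloisRep 3 → (∀ X₀ Y₀ : ℚ, ¬ IsShortThreeTorsion W D.c X₀ Y₀) →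
      CuspidalPlusDefectPrimeTo 3 D) :
    NoRationalThreeTorsionCoprimeIsolatedResidual :=
  noRationalThreeTorsionCoprimeIsolatedResidual_of_sharp hnf hF hK
    (plusIndexPrimeToThreeOfMuThreeNoRationalThreeTorsion_of_cuspLifting h128) hpd

end Summit.BirchSwinnertonDyer.BirchSwinnertonDyer.Theorems.ManinLocalTwoThree

end
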